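import Summits.Ventures.WeilGRH.FrontierDoubleRungsSqrt
import Summits.Ventures.WeilGRH.CensusFrontierDoubleComplex
import HarnessLib

/-!
# GRH arm (rh-explicit, venture WeilGRH): the `ζ` frontier `4023/5000` for the named census characters with `χ(2) = e(±1/8), e(±3/8)`

Cell `rh-explicit`, WEIL TRACK — GRH ARM, seat weil-grh-2 (gen3). Discharge of `FrontierDoubleRungsSqrt.lean` for the census
characters `17.5, 17.12` (`χ(2) = e(3/8)`), `17.7, 17.10` (`χ(2) = e(5/8)`), `17.11` (`e(1/8)`), `17.14` (`e(7/8)`): each is the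
tree theorem `WeilPositivityOnChar χ (4023/5000)`. With `CensusFrontierDouble{,Complex}.lean`: 14 of the 46 conjugacy classes of
conductor `≤ 20` are PROVED at the `ζ` frontier (mod `17`: six of the eight classes — all but `17.2/17.9` and `17.3/17.6`,
whose double-transfer values `1.96`, `1.74` fall short of `2`). No named facts.
-/

noncomputable section

open Complex
open scoped Real ComplexConjugate

namespace Summit.Ventures.WeilGRH

open Literature.NumberTheory.LFunctions

/-- `e^{iθ} = cos θ + i sin θ` with real casts. [folklore] -/
theorem cexp_real_mul_I (θ : ℝ) :
    cexp ((θ : ℂ) * I) = ((Real.cos θ : ℝ) : ℂ) + ((Real.sin θ : ℝ) : ℂ) * I := by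
  rw [Complex.exp_mul_I, ← Complex.ofReal_cos, ← Complex.ofReal_sin]

/-- The four eighth roots met at `k = 2`: `e(6/16) = e(3/8)`, `e(10/16) = e(5/8)`, `e(2/16) = e(1/8)`, `e(14/16) = e(7/8)`. [folklore] -/
theorem cexp_eighth_values :
    cexp (((2 * π * ((6 : ℕ) : ℝ) / ((16 : ℕ) : ℝ) : ℝ) : ℂ) * I) =
      ((((-(Real.sqrt 2 / 2)) : ℝ) : ℂ) + ((Real.sqrt 2 / 2 : ℝ) : ℂ) * I) ∧
    cexp (((2 * π * ((10 : ℕ) : ℝ) / ((16 : ℕ) : ℝ) : ℝ) : ℂ) * I) =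
      ((((-(Real.sqrt 2 / 2)) : ℝ) : ℂ) + (((-(Real.sqrt 2 / 2)) : ℝ) : ℂ) * I) ∧
    cexp (((2 * π * ((2 : ℕ) : ℝ) / ((16 : ℕ) : ℝ) : ℝ) : ℂ) * I) =
      (((Real.sqrt 2 / 2 : ℝ) : ℂ) + ((Real.sqrt 2 / 2 : ℝ) : ℂ) * I) ∧
    cexp (((2 * π * ((14 : ℕ) : ℝ) / ((16 : ℕ) : ℝ) : ℝ) : ℂ) * I) =
      (((Real.sqrt 2 / 2 : ℝ) : ℂ) + (((-(Real.sqrt 2 / 2)) : ℝ) : ℂ) * I) := by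
  refine ⟨?_, ?_, ?_, ?_⟩
  · rw [cexp_real_mul_I, show (2 * π * ((6 : ℕ) : ℝ) / ((16 : ℕ) : ℝ) : ℝ) = π - π / 4 by push_cast; ring,
      Real.cos_pi_sub, Real.sin_pi_sub, Real.cos_pi_div_four, Real.sin_pi_div_four]
  · rw [cexp_real_mul_I, show (2 * π * ((10 : ℕ) : ℝ) / ((16 : ℕ) : ℝ) : ℝ) = π / 4 + π by push_cast; ring,
      Real.cos_add_pi, Real.sin_add_pi, Real.cos_pi_div_four, Real.sin_pi_div_four]
  · rw [cexp_real_mul_I, show (2 * π * ((2 : ℕ) : ℝ) / ((16 : ℕ) : ℝ) : ℝ) = π / 4 by push_cast; ring,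
      Real.cos_pi_div_four, Real.sin_pi_div_four]
  · rw [cexp_real_mul_I, show (2 * π * ((14 : ℕ) : ℝ) / ((16 : ℕ) : ℝ) : ℝ) = 2 * π - π / 4 by push_cast; ring,
      Real.cos_two_pi_sub, Real.sin_two_pi_sub, Real.cos_pi_div_four, Real.sin_pi_div_four]

/-- `χ(4)` for these rows: `e(12/16) = −i`, `e(4/16) = i`. [folklore] -/
theorem cexp_fourth_values :
    cexp (((2 * π * ((12 : ℕ) : ℝ) / ((16 : ℕ) : ℝ) : ℝ) : ℂ) * I) = -I ∧
    cexp (((2 * π * ((4 : ℕ) : ℝ) / ((16 : ℕ) : ℝ) : ℝ) : ℂ) * I) = I := by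
  have e1 : (2 * π * ((12 : ℕ) : ℝ) / ((16 : ℕ) : ℝ) : ℝ) = π / 2 + π := by push_cast; ring
  have e2 : (2 * π * ((4 : ℕ) : ℝ) / ((16 : ℕ) : ℝ) : ℝ) = π / 2 := by push_cast; ring
  constructor
  · rw [e1]; exact cexp_mul_I_eq_neg_I (by rw [Real.cos_add_pi, Real.cos_pi_div_two]; norm_num)
      (by rw [Real.sin_add_pi, Real.sin_pi_div_two])
  · rw [e2]; exact cexp_mul_I_eq_I Real.cos_pi_div_two Real.sin_pi_div_two

/-- **Cell 17.5 at `4023/5000`** (`χ(2) = e(6/16)`, `χ(4) = e(12/16)`, `χ(3) = e(5/16)`). -/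
theorem weilPositivityOnChar_frontier_census_17_5 :
    WeilPositivityOnChar ((censusRow 17 5).toChar (census20_check _ (by decide))) (4023 / 5000) := by
  have h2 : (censusRow 17 5).toChar (census20_check _ (by decide)) (2 : ZMod _) = ((((-(Real.sqrt 2 / 2)) : ℝ) : ℂ) + ((Real.sqrt 2 / 2 : ℝ) : ℂ) * I) := by
    rw [two_eq_natCast'', censusRow_toChar_natCast _ 2 (by decide), show (censusRow 17 5).e 2 = 6 by decide,
      show (censusRow 17 5).ord = 16 by decide]
    exact cexp_eighth_values.1
  have h4 : (censusRow 17 5).toChar (census20_check _ (by decide)) (4 : ZMod _) = -I := by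
    rw [show (4 : ZMod (censusRow 17 5).q) = ((4 : ℕ) : ZMod _) by norm_cast, censusRow_toChar_natCast _ 4 (by decide),
      show (censusRow 17 5).e 4 = 12 by decide, show (censusRow 17 5).ord = 16 by decide]
    exact cexp_fourth_values.1
  have h3 : (2.7652 : ℝ) ≤ ‖1 - (censusRow 17 5).toChar (census20_check _ (by decide)) (3 : ZMod _)‖ ^ 2 ∧
      ‖1 - (censusRow 17 5).toChar (census20_check _ (by decide)) (3 : ZMod _)‖ ^ 2 ≤ 2.7655 := by
    rw [three_eq_natCast'', normSq_one_sub_censusChar _ 3 (by decide), show (censusRow 17 5).e 3 = 5 by decide,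
      show (censusRow 17 5).ord = 16 by decide]
    exact twoSubTwoCos_5_16
  exact weilPositivityOnChar_frontier_class_17_5 (by decide) _ h2 h4 h3.1 h3.2

/-- **Cell 17.12 at `4023/5000`** (`χ(2) = e(6/16)`, `χ(4) = e(12/16)`, `χ(3) = e(13/16)`). -/
theorem weilPositivityOnChar_frontier_census_17_12 :
    WeilPositivityOnChar ((censusRow 17 12).toChar (census20_check _ (by decide))) (4023 / 5000) := by
  have h2 : (censusRow 17 12).toChar (census20_check _ (by decide)) (2 : ZMod _) = ((((-(Real.sqrt 2 / 2)) : ℝ) : ℂ) + ((Real.sqrt 2 / 2 : ℝ) : ℂ) * I) := by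
    rw [two_eq_natCast'', censusRow_toChar_natCast _ 2 (by decide), show (censusRow 17 12).e 2 = 6 by decide,
      show (censusRow 17 12).ord = 16 by decide]
    exact cexp_eighth_values.1
  have h4 : (censusRow 17 12).toChar (census20_check _ (by decide)) (4 : ZMod _) = -I := by
    rw [show (4 : ZMod (censusRow 17 12).q) = ((4 : ℕ) : ZMod _) by norm_cast, censusRow_toChar_natCast _ 4 (by decide),
      show (censusRow 17 12).e 4 = 12 by decide, show (censusRow 17 12).ord = 16 by decide]
    exact cexp_fourth_values.1
  have h3 : (1.2345 : ℝ) ≤ ‖1 - (censusRow 17 12).toChar (census20_check _ (by decide)) (3 : ZMod _)‖ ^ 2 ∧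
      ‖1 - (censusRow 17 12).toChar (census20_check _ (by decide)) (3 : ZMod _)‖ ^ 2 ≤ 1.2348 := by
    rw [three_eq_natCast'', normSq_one_sub_censusChar _ 3 (by decide), show (censusRow 17 12).e 3 = 13 by decide,
      show (censusRow 17 12).ord = 16 by decide]
    exact twoSubTwoCos_13_16
  exact weilPositivityOnChar_frontier_class_17_12 (by decide) _ h2 h4 h3.1 h3.2

/-- **Cell 17.7 at `4023/5000`** (`χ(2) = e(10/16)`, `χ(4) = e(4/16)`, `χ(3) = e(11/16)`). -/
theorem weilPositivityOnChar_frontier_census_17_7 :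
    WeilPositivityOnChar ((censusRow 17 7).toChar (census20_check _ (by decide))) (4023 / 5000) := by
  have h2 : (censusRow 17 7).toChar (census20_check _ (by decide)) (2 : ZMod _) = ((((-(Real.sqrt 2 / 2)) : ℝ) : ℂ) + (((-(Real.sqrt 2 / 2)) : ℝ) : ℂ) * I) := by
    rw [two_eq_natCast'', censusRow_toChar_natCast _ 2 (by decide), show (censusRow 17 7).e 2 = 10 by decide,
      show (censusRow 17 7).ord = 16 by decide]
    exact cexp_eighth_values.2.1
  have h4 : (censusRow 17 7).toChar (census20_check _ (by decide)) (4 : ZMod _) = I := by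
    rw [show (4 : ZMod (censusRow 17 7).q) = ((4 : ℕ) : ZMod _) by norm_cast, censusRow_toChar_natCast _ 4 (by decide),
      show (censusRow 17 7).e 4 = 4 by decide, show (censusRow 17 7).ord = 16 by decide]
    exact cexp_fourth_values.2
  have h3 : (2.7652 : ℝ) ≤ ‖1 - (censusRow 17 7).toChar (census20_check _ (by decide)) (3 : ZMod _)‖ ^ 2 ∧
      ‖1 - (censusRow 17 7).toChar (census20_check _ (by decide)) (3 : ZMod _)‖ ^ 2 ≤ 2.7655 := by
    rw [three_eq_natCast'', normSq_one_sub_censusChar _ 3 (by decide), show (censusRow 17 7).e 3 = 11 by decide,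
      show (censusRow 17 7).ord = 16 by decide]
    exact twoSubTwoCos_11_16
  exact weilPositivityOnChar_frontier_class_17_7 (by decide) _ h2 h4 h3.1 h3.2

/-- **Cell 17.10 at `4023/5000`** (`χ(2) = e(10/16)`, `χ(4) = e(4/16)`, `χ(3) = e(3/16)`). -/
theorem weilPositivityOnChar_frontier_census_17_10 :
    WeilPositivityOnChar ((censusRow 17 10).toChar (census20_check _ (by decide))) (4023 / 5000) := by
  have h2 : (censusRow 17 10).toChar (census20_check _ (by decide)) (2 : ZMod _) = ((((-(Real.sqrt 2 / 2)) : ℝ) : ℂ) + (((-(Real.sqrt 2 / 2)) : ℝ) : ℂ) * I) := by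
    rw [two_eq_natCast'', censusRow_toChar_natCast _ 2 (by decide), show (censusRow 17 10).e 2 = 10 by decide,
      show (censusRow 17 10).ord = 16 by decide]
    exact cexp_eighth_values.2.1
  have h4 : (censusRow 17 10).toChar (census20_check _ (by decide)) (4 : ZMod _) = I := by
    rw [show (4 : ZMod (censusRow 17 10).q) = ((4 : ℕ) : ZMod _) by norm_cast, censusRow_toChar_natCast _ 4 (by decide),
      show (censusRow 17 10).e 4 = 4 by decide, show (censusRow 17 10).ord = 16 by decide]
    exact cexp_fourth_values.2
  have h3 : (1.2345 : ℝ) ≤ ‖1 - (censusRow 17 10).toChar (census20_check _ (by decide)) (3 : ZMod _)‖ ^ 2 ∧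
      ‖1 - (censusRow 17 10).toChar (census20_check _ (by decide)) (3 : ZMod _)‖ ^ 2 ≤ 1.2348 := by
    rw [three_eq_natCast'', normSq_one_sub_censusChar _ 3 (by decide), show (censusRow 17 10).e 3 = 3 by decide,
      show (censusRow 17 10).ord = 16 by decide]
    exact twoSubTwoCos_3_16
  exact weilPositivityOnChar_frontier_class_17_10 (by decide) _ h2 h4 h3.1 h3.2

/-- **Cell 17.11 at `4023/5000`** (`χ(2) = e(2/16)`, `χ(4) = e(4/16)`, `χ(3) = e(7/16)`). -/
theorem weilPositivityOnChar_frontier_census_17_11 :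
    WeilPositivityOnChar ((censusRow 17 11).toChar (census20_check _ (by decide))) (4023 / 5000) := by
  have h2 : (censusRow 17 11).toChar (census20_check _ (by decide)) (2 : ZMod _) = (((Real.sqrt 2 / 2 : ℝ) : ℂ) + ((Real.sqrt 2 / 2 : ℝ) : ℂ) * I) := by
    rw [two_eq_natCast'', censusRow_toChar_natCast _ 2 (by decide), show (censusRow 17 11).e 2 = 2 by decide,
      show (censusRow 17 11).ord = 16 by decide]
    exact cexp_eighth_values.2.2.1
  have h4 : (censusRow 17 11).toChar (census20_check _ (by decide)) (4 : ZMod _) = I := by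
    rw [show (4 : ZMod (censusRow 17 11).q) = ((4 : ℕ) : ZMod _) by norm_cast, censusRow_toChar_natCast _ 4 (by decide),
      show (censusRow 17 11).e 4 = 4 by decide, show (censusRow 17 11).ord = 16 by decide]
    exact cexp_fourth_values.2
  have h3 : (3.8476 : ℝ) ≤ ‖1 - (censusRow 17 11).toChar (census20_check _ (by decide)) (3 : ZMod _)‖ ^ 2 ∧
      ‖1 - (censusRow 17 11).toChar (census20_check _ (by decide)) (3 : ZMod _)‖ ^ 2 ≤ 3.8479 := by
    rw [three_eq_natCast'', normSq_one_sub_censusChar _ 3 (by decide), show (censusRow 17 11).e 3 = 7 by decide,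
      show (censusRow 17 11).ord = 16 by decide]
    exact twoSubTwoCos_7_16
  exact weilPositivityOnChar_frontier_class_17_11 (by decide) _ h2 h4 h3.1 h3.2

/-- **Cell 17.14 at `4023/5000`** (`χ(2) = e(14/16)`, `χ(4) = e(12/16)`, `χ(3) = e(9/16)`). -/
theorem weilPositivityOnChar_frontier_census_17_14 :
    WeilPositivityOnChar ((censusRow 17 14).toChar (census20_check _ (by decide))) (4023 / 5000) := by
  have h2 : (censusRow 17 14).toChar (census20_check _ (by decide)) (2 : ZMod _) = (((Real.sqrt 2 / 2 : ℝ) : ℂ) + (((-(Real.sqrt 2 / 2)) : ℝ) : ℂ) * I) := by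
    rw [two_eq_natCast'', censusRow_toChar_natCast _ 2 (by decide), show (censusRow 17 14).e 2 = 14 by decide,
      show (censusRow 17 14).ord = 16 by decide]
    exact cexp_eighth_values.2.2.2
  have h4 : (censusRow 17 14).toChar (census20_check _ (by decide)) (4 : ZMod _) = -I := by
    rw [show (4 : ZMod (censusRow 17 14).q) = ((4 : ℕ) : ZMod _) by norm_cast, censusRow_toChar_natCast _ 4 (by decide),
      show (censusRow 17 14).e 4 = 12 by decide, show (censusRow 17 14).ord = 16 by decide]
    exact cexp_fourth_values.1
  have h3 : (3.8476 : ℝ) ≤ ‖1 - (censusRow 17 14).toChar (census20_check _ (by decide)) (3 : ZMod _)‖ ^ 2 ∧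
      ‖1 - (censusRow 17 14).toChar (census20_check _ (by decide)) (3 : ZMod _)‖ ^ 2 ≤ 3.8479 := by
    rw [three_eq_natCast'', normSq_one_sub_censusChar _ 3 (by decide), show (censusRow 17 14).e 3 = 9 by decide,
      show (censusRow 17 14).ord = 16 by decide]
    exact twoSubTwoCos_9_16
  exact weilPositivityOnChar_frontier_class_17_14 (by decide) _ h2 h4 h3.1 h3.2

end Summit.Ventures.WeilGRH
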